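/-
Copyright (c) 2026 the pub-hodgecm-mathlib formalisation cell (harness21).  Prover seat hodgecm-mathlib-LA1-p02 (g2), P6 «MOD programme», line L2,
organ (ρ1) «REDUCED ROOF HOM» of `stub_SPGEOM`'s `RedHomLaw` road (LA2-plan (g0) «ρ-ROAD v2», 2026-09-02T05:36:25Z); 2026-09-02.
-/
import Literature.AlgebraicGeometry.AbelianSchemes.AbelianSchemeHomReductionSpecialFibreModel
import Literature.AlgebraicGeometry.AbelianSchemes.AbelianSchemeFibreBaseChangeHom
import Literature.AlgebraicGeometry.AbelianSchemes.AbelianSchemeFibreFrobeniusTwistHom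
import HarnessLib

/-!
# REDUCTION OF A HOMOMORPHISM BETWEEN THE GENERIC FIBRES OF THE VALUATION-RING MODELS, READ ON THEIR SPECIAL FIBRES
# ([SerreTate1968] §1 Lemma 2; [BoschLutkebohmertRaynaud1990] §7.3 Prop. 6 — the `𝒜_x̃`-currency corollary of ★ (ν8R-model))

Topic `AlgebraicGeometry/AbelianSchemes`, namespace `Literature.AlgebraicGeometry.AbelianSchemes.AbelianSchemeOver`.  THEOREMS ONLY (no definition, no named fact, no
instance, no notation, no `sorry`).  Cell `hodgecm-mathlib` (D-0151), F0∕P6 «MOD» (crux hLiu418 = stmt-HodgeConjecture-24832, `--supports`, count-neutral), line L2, organ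
(ρ1) «reduced roof hom» of the L2 closer's `RedHomLaw` — the CURRENCY CHANGE the L2 leaflet needs: ★ (ν8R-model) `exists_specialFibre_hom_reduction_model` speaks of
`u : (𝒜_η)_x → (𝒞_η)_{x″}` and `ū : (𝒜_s)_{x̄} → (𝒞_s)_{x̄″}` (iterated base changes along `ι_η`∕`ι_s` then the point), while the leaflet's layer `layerR ⊂ famOf = 𝒜_x̃`,
its presentation isomorphisms (σ2)∕(σ3) and its dock identification `ε` all live on the FIBRES OF THE `R`-MODEL `𝒜_x̃ := 𝒜 ×_𝓨 Spec R` (`x̃` the `R`-point extending `x`,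
`R = 𝒪_Ω̄`): `(𝒜_x̃)_η := 𝒜_x̃ ×_R Spec Ω̄` and `(𝒜_x̃)_s̄ := 𝒜_x̃ ×_R Spec κ̄`.  HERE: for a homomorphism `v : (𝒜_x̃)_η → (𝒞_x̃″)_η` there is a homomorphism
`v̄ : (𝒜_x̃)_s̄ → (𝒞_x̃″)_s̄` — at ANY special base point `s̄ : Spec κ̄ → Spec R` equal to the ★ (d5) geometric closed point `c⁻¹ ≫ Spec (residue R)` (a BINDER, so that
consumers instantiate `s̄ := Spec (algebraMap R κ̄)` under their own `Algebra R κ̄`) — with (i) `v` finite surjective ⇒ `v̄` flat surjective; (ii) EQUIVARIANCE for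
endomorphism pairs `(f, g)` of `(𝒜, 𝒞)` in the model currency `(f ×_𝓨 x̃)_η`, `(f ×_𝓨 x̃)_s̄`; (v-b) KILL: for `incl : 𝒦 → 𝒜_x̃` with `𝒦 → Spec R` flat, `incl_η ≫ v = 1 ⇒
incl_s̄ ≫ v̄ = 1` — NO three-piece isomorphism left in the statement.  PROOF: `u := T_η(x) ≫ v ≫ T_η(x″)⁻¹` and `v̄ := T_s(x)⁻¹ ≫ ū ≫ T_s(x″)` with the ★ (d5) three-piece
isomorphisms `T`, which are natural in the family endomorphisms (★ `fibreHom_baseChangeHom_comp_fibreBaseChangeIso_hom`, ★ `fibreHom_comp_fibreCongrPtIso_hom`).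
HONEST LABEL: HC_CM is proved only modulo the cell's 2 remaining named inputs (hLiu418 24832, h413 24833) until rung 0 closes; generic capital, pays no letter.

* §1 `comp_three_hom_eq`, `three_inv_comp_eq` (naturality of the three-piece isomorphism in the model currency; private bookkeeping);
* §2 HEAD **`exists_hom_modelSpecialFibre_of_hom_modelGenericFibre`**.

## References
* [SerreTate1968] J.-P. Serre, J. Tate, *Good reduction of abelian varieties*, Ann. of Math. 88 (1968), §1 Lemma 2, Theorem 1.
* [BoschLutkebohmertRaynaud1990] S. Bosch, W. Lütkebohmert, M. Raynaud, *Néron Models* (1990), §1.2 Prop. 8, §7.3 Prop. 6 (p. 180).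
* [GortzWedhorn2020] U. Görtz, T. Wedhorn, *Algebraic Geometry I*, 2nd ed. (2020), Section (4.7) (p. 135), Prop. 4.16.
* [MumfordFogartyKirwan1994] D. Mumford, J. Fogarty, F. Kirwan, *GIT*, 3rd ed., Ch. 7 §2 Def. 7.2 (p. 129).
* [Hartshorne1977] R. Hartshorne, *Algebraic Geometry*, II.4.7.
-/

set_option autoImplicit false

noncomputable section

set_option backward.isDefEq.respectTransparency false

open CategoryTheory CategoryTheory.Limits AlgebraicGeometry
open scoped MonObj CategoryTheory.Obj NumberField
open Literature.AlgebraicGeometry.Motives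
open IsDedekindDomain IsDedekindDomain.HeightOneSpectrum ValuativeRel
open Literature.NumberTheory.EllipticCurves (genericFibre specGenericPoint)
open Literature.NumberTheory.GaloisRepresentations (closureValuationSubring)
open Literature.NumberTheory.DiophantineGeometry

namespace Literature.AlgebraicGeometry.AbelianSchemes

namespace AbelianSchemeOver

universe u

/-! ## §1 Bookkeeping: the three-piece isomorphism is natural in the family endomorphisms; iso components are isomorphisms -/

section Bookkeeping

/-- Composition of morphisms of abelian varieties, read on the underlying group-scheme morphisms. [folklore] -/
private theorem av_comp_hom_hom_hom {k : Type u} [Field k] {X Y Z : AbelianVariety k} (φ : X ⟶ Y) (ψ : Y ⟶ Z) :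
    (φ ≫ ψ).hom.hom.hom = φ.hom.hom.hom ≫ ψ.hom.hom.hom := rfl

/-- For an isomorphism of abelian varieties, `e⁻¹ ≫ e = 𝟙` on the underlying morphisms. [folklore] -/
private theorem avIso_inv_hom_hom_hom_comp_hom {k : Type u} [Field k] {X Y : AbelianVariety k} (e : X ≅ Y) :
    e.inv.hom.hom.hom ≫ e.hom.hom.hom.hom = 𝟙 _ :=
  AbelianVariety.iso_hom_hom_hom_hom_comp_inv e.symm

/-- The underlying scheme morphism of an isomorphism of abelian varieties is an isomorphism. [folklore] -/
private theorem isIso_left_hom_of_avIso {k : Type u} [Field k] {X Y : AbelianVariety k} (e : X ≅ Y) : IsIso e.hom.hom.hom.hom.left := by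
  haveI : IsIso e.hom.hom.hom.hom :=
    ⟨⟨e.inv.hom.hom.hom, AbelianVariety.iso_hom_hom_hom_hom_comp_inv e, avIso_inv_hom_hom_hom_comp_hom e⟩⟩
  change IsIso ((Over.forget _).map e.hom.hom.hom.hom)
  infer_instance

/-- … and of its inverse. [folklore] -/
private theorem isIso_left_inv_of_avIso {k : Type u} [Field k] {X Y : AbelianVariety k} (e : X ≅ Y) : IsIso e.inv.hom.hom.hom.left :=
  isIso_left_hom_of_avIso e.symm

variable {T Ug Vr : Scheme.{u}} {Ω : Type u} [Field Ω] (j : Ug ⟶ T) (y : Spec (.of Ω) ⟶ Ug) (xR : Vr ⟶ T) (ηp : Spec (.of Ω) ⟶ Vr)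
  (hpt : y ≫ j = ηp ≫ xR) (𝒜 ℬ : AbelianSchemeOver T)

/-- **NATURALITY OF THE THREE-PIECE ISOMORPHISM** `(𝒜|_U)_y ≅ 𝒜_(y ≫ j) = 𝒜_(ηp ≫ x_R) ≅ (𝒜_{x_R})_η` (★ (d5)) in a homomorphism `f : 𝒜 → ℬ` of abelian `T`-schemes, read
on the underlying morphisms: `((f|_U)_y) ≫ T_ℬ = T_𝒜 ≫ (f ×_T x_R)_η` (★ `fibreHom_baseChangeHom_comp_fibreBaseChangeIso_hom` twice and ★ `fibreHom_comp_fibreCongrPtIso_hom`).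
[cite: GortzWedhorn2020, Section (4.7) (p. 135) and Prop. 4.16] [cite: MumfordFogartyKirwan1994, Ch. 7 §2 Definition 7.2 (p. 129)] -/
theorem comp_three_hom_eq (f : 𝒜.X ⟶ ℬ.X) [IsMonHom f] :
    baseChangeHom (baseChangeHom f j) y ≫ (ℬ.fibreBaseChangeIso j y ≪≫ ℬ.fibreCongrPtIso hpt ≪≫ (ℬ.fibreBaseChangeIso xR ηp).symm).hom.hom.hom.hom =
      (𝒜.fibreBaseChangeIso j y ≪≫ 𝒜.fibreCongrPtIso hpt ≪≫ (𝒜.fibreBaseChangeIso xR ηp).symm).hom.hom.hom.hom ≫ (Over.pullback ηp).map (baseChangeHom f xR) := by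
  haveI := isMonHom_baseChangeHom f j
  haveI := isMonHom_baseChangeHom f xR
  have h : fibreHom (baseChangeHom f j) y ≫ (ℬ.fibreBaseChangeIso j y ≪≫ ℬ.fibreCongrPtIso hpt ≪≫ (ℬ.fibreBaseChangeIso xR ηp).symm).hom =
      (𝒜.fibreBaseChangeIso j y ≪≫ 𝒜.fibreCongrPtIso hpt ≪≫ (𝒜.fibreBaseChangeIso xR ηp).symm).hom ≫ fibreHom (baseChangeHom f xR) ηp := by
    simp only [Iso.trans_hom, Iso.symm_hom]
    rw [← Category.assoc, fibreHom_baseChangeHom_comp_fibreBaseChangeIso_hom, Category.assoc, ← Category.assoc (fibreHom f (y ≫ j)),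
      fibreHom_comp_fibreCongrPtIso_hom, Category.assoc, fibreHom_comp_fibreBaseChangeIso_inv]
    simp only [Category.assoc]
  have h' := congrArg (fun φ => φ.hom.hom.hom) h
  simpa only [av_comp_hom_hom_hom, fibreHom_hom_hom_hom] using h'

/-- Inverse form: `T_𝒜⁻¹ ≫ (f|_U)_y = (f ×_T x_R)_η ≫ T_ℬ⁻¹`. [cite: GortzWedhorn2020, Section (4.7) (p. 135) and Prop. 4.16] -/
theorem three_inv_comp_eq (f : 𝒜.X ⟶ ℬ.X) [IsMonHom f] :
    (𝒜.fibreBaseChangeIso j y ≪≫ 𝒜.fibreCongrPtIso hpt ≪≫ (𝒜.fibreBaseChangeIso xR ηp).symm).inv.hom.hom.hom ≫ baseChangeHom (baseChangeHom f j) y =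
      (Over.pullback ηp).map (baseChangeHom f xR) ≫ (ℬ.fibreBaseChangeIso j y ≪≫ ℬ.fibreCongrPtIso hpt ≪≫ (ℬ.fibreBaseChangeIso xR ηp).symm).inv.hom.hom.hom := by
  have h := comp_three_hom_eq j y xR ηp hpt 𝒜 ℬ f
  have h1 := congrArg (fun φ => (𝒜.fibreBaseChangeIso j y ≪≫ 𝒜.fibreCongrPtIso hpt ≪≫ (𝒜.fibreBaseChangeIso xR ηp).symm).inv.hom.hom.hom ≫ φ ≫
    (ℬ.fibreBaseChangeIso j y ≪≫ ℬ.fibreCongrPtIso hpt ≪≫ (ℬ.fibreBaseChangeIso xR ηp).symm).inv.hom.hom.hom) h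
  simp only [Category.assoc, AbelianVariety.iso_hom_hom_hom_hom_comp_inv] at h1
  rw [← Category.assoc ((𝒜.fibreBaseChangeIso j y ≪≫ 𝒜.fibreCongrPtIso hpt ≪≫ (𝒜.fibreBaseChangeIso xR ηp).symm).inv.hom.hom.hom)
    ((𝒜.fibreBaseChangeIso j y ≪≫ 𝒜.fibreCongrPtIso hpt ≪≫ (𝒜.fibreBaseChangeIso xR ηp).symm).hom.hom.hom.hom), avIso_inv_hom_hom_hom_comp_hom,
    Category.id_comp] at h1
  exact h1

end Bookkeeping

/-! ## §2 HEAD: the reduction read on the fibres of the `R`-models -/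

section Head

variable {K : Type} [Field K] [NumberField K] {v : HeightOneSpectrum (𝓞 K)} {Y : SchemeOver K}
  (𝓨 : IntegralModel (valuationSubringAtPrime K v) K Y) [IsProper 𝓨.total.hom]
  (𝒜 𝒞 : AbelianSchemeOver 𝓨.total.left) (x x'' : AlgPoints Y (AlgebraicClosure (v.adicCompletion K)))

set_option maxHeartbeats 800000 in
set_option synthInstance.maxHeartbeats 200000 in
/-- **REDUCTION OF A HOMOMORPHISM BETWEEN THE GENERIC FIBRES OF THE `R`-MODELS, READ ON THEIR SPECIAL FIBRES.**  `𝓨` a proper model at `v`, `𝒜, 𝒞 → 𝓨` abelian schemes,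
`x, x″ ∈ Y(Ω̄)`, `R = 𝒪_Ω̄`, `x̃, x̃″` the `R`-points extending `x, x″`, `𝒜_x̃ := 𝒜 ×_𝓨 Spec R`, `𝒞_x̃″ := 𝒞 ×_𝓨 Spec R`, `η_R : Spec Ω̄ → Spec R` the generic point, `s̄ : Spec κ̄ → Spec R`
ANY morphism equal to the ★ (d5) geometric closed point `c⁻¹ ≫ Spec (residue R)`.  For every homomorphism `v : (𝒜_x̃)_{η_R} → (𝒞_x̃″)_{η_R}` there is a homomorphism
`v̄ : (𝒜_x̃)_s̄ → (𝒞_x̃″)_s̄` with: (i) `v` finite surjective ⇒ `v̄` flat surjective; (ii) for endomorphisms `f` of `𝒜`, `g` of `𝒞` with `(f ×_𝓨 x̃)_η ≫ v = v ≫ (g ×_𝓨 x̃″)_η`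
also `(f ×_𝓨 x̃)_s̄ ≫ v̄ = v̄ ≫ (g ×_𝓨 x̃″)_s̄`; (v-b) for `incl : 𝒦 → 𝒜_x̃` with `𝒦 → Spec R` FLAT, `incl_η ≫ v = 1 ⇒ incl_s̄ ≫ v̄ = 1`.  (★ (ν8R-model)
`exists_specialFibre_hom_reduction_model` at `u := T_η(x) ≫ v ≫ T_η(x″)⁻¹`, `v̄ := T_s(x)⁻¹ ≫ ū ≫ T_s(x″)`, §1 naturality.)
[cite: SerreTate1968, §1 Lemma 2 and Theorem 1] [cite: BoschLutkebohmertRaynaud1990, §1.2 Prop. 8 and §7.3 Prop. 6 (p. 180)] [cite: Hartshorne1977, II.4.7]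
[cite: MumfordFogartyKirwan1994, Ch. 7 §2 Definition 7.2 (p. 129)] -/
theorem exists_hom_modelSpecialFibre_of_hom_modelGenericFibre
    (sbar : Spec (.of (geomResidueField v)) ⟶ Spec (.of (closureValuationSubring (v.adicCompletion K))))
    (hsb : sbar = (geomClosedPointIsoSpecResidueField v).inv.left ≫
      (specRingHomι (closureValuationSubring (v.adicCompletion K)) (toClosureValuationSubring v)
        (IsLocalRing.residue (closureValuationSubring (v.adicCompletion K)))).left)
    (v_ : ((𝒜.baseChange (extendPoint (closureValuationSubring (v.adicCompletion K)) (toClosureValuationSubring v) 𝓨.total (𝓨.modelPointsEquiv.symm x)).left).baseChange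
            (specFractionFieldι (closureValuationSubring (v.adicCompletion K)) (toClosureValuationSubring v)).left).X ⟶
          ((𝒞.baseChange (extendPoint (closureValuationSubring (v.adicCompletion K)) (toClosureValuationSubring v) 𝓨.total (𝓨.modelPointsEquiv.symm x'')).left).baseChange
            (specFractionFieldι (closureValuationSubring (v.adicCompletion K)) (toClosureValuationSubring v)).left).X)
    [IsMonHom v_] :
    ∃ (vbar : ((𝒜.baseChange (extendPoint (closureValuationSubring (v.adicCompletion K)) (toClosureValuationSubring v) 𝓨.total (𝓨.modelPointsEquiv.symm x)).left).baseChange sbar).X ⟶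
               ((𝒞.baseChange (extendPoint (closureValuationSubring (v.adicCompletion K)) (toClosureValuationSubring v) 𝓨.total (𝓨.modelPointsEquiv.symm x'')).left).baseChange sbar).X)
      (_ : IsMonHom vbar),
      -- (i) finite surjective ⇒ flat surjective
      (IsFinite v_.left → Surjective v_.left → Flat vbar.left ∧ Surjective vbar.left) ∧
      -- (ii) equivariance for endomorphism pairs, in the model currency
      (∀ (f : 𝒜.X ⟶ 𝒜.X) (g : 𝒞.X ⟶ 𝒞.X) [IsMonHom f] [IsMonHom g],
        (Over.pullback (specFractionFieldι (closureValuationSubring (v.adicCompletion K)) (toClosureValuationSubring v)).left).map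
            (baseChangeHom f (extendPoint (closureValuationSubring (v.adicCompletion K)) (toClosureValuationSubring v) 𝓨.total (𝓨.modelPointsEquiv.symm x)).left) ≫ v_ =
          v_ ≫ (Over.pullback (specFractionFieldι (closureValuationSubring (v.adicCompletion K)) (toClosureValuationSubring v)).left).map
            (baseChangeHom g (extendPoint (closureValuationSubring (v.adicCompletion K)) (toClosureValuationSubring v) 𝓨.total (𝓨.modelPointsEquiv.symm x'')).left) →
        (Over.pullback sbar).map
            (baseChangeHom f (extendPoint (closureValuationSubring (v.adicCompletion K)) (toClosureValuationSubring v) 𝓨.total (𝓨.modelPointsEquiv.symm x)).left) ≫ vbar =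
          vbar ≫ (Over.pullback sbar).map
            (baseChangeHom g (extendPoint (closureValuationSubring (v.adicCompletion K)) (toClosureValuationSubring v) 𝓨.total (𝓨.modelPointsEquiv.symm x'')).left)) ∧
      -- (v-b) KILL along a flat `𝒦 → 𝒜_x̃`
      (∀ (𝒦 : Over (Spec (.of (closureValuationSubring (v.adicCompletion K)))))
        (incl : 𝒦 ⟶ (𝒜.baseChange (extendPoint (closureValuationSubring (v.adicCompletion K)) (toClosureValuationSubring v) 𝓨.total (𝓨.modelPointsEquiv.symm x)).left).X)
        [Flat 𝒦.hom],
        (Over.pullback (specFractionFieldι (closureValuationSubring (v.adicCompletion K)) (toClosureValuationSubring v)).left).map incl ≫ v_ = 1 →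
        (Over.pullback sbar).map incl ≫ vbar = 1) := by
  subst hsb
  -- the three-piece isomorphisms of ★ (d5), generic and special, for `𝒜` at `x` and `𝒞` at `x″`
  have hptA := (𝓨.left_specFractionFieldι_comp_extendPoint_modelPointsEquiv_symm x).symm
  have hptC := (𝓨.left_specFractionFieldι_comp_extendPoint_modelPointsEquiv_symm x'').symm
  have hsptA := (𝓨.left_geomReductionMap_comp_fst x).trans (Category.assoc _ _ _).symm
  have hsptC := (𝓨.left_geomReductionMap_comp_fst x'').trans (Category.assoc _ _ _).symm
  set TA := 𝒜.fibreBaseChangeIso (𝓨.genericIso'.inv.left ≫ pullback.fst 𝓨.total.hom (specGenericPoint (valuationSubringAtPrime K v) K)) x.left ≪≫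
      𝒜.fibreCongrPtIso hptA ≪≫ (𝒜.fibreBaseChangeIso (extendPoint (closureValuationSubring (v.adicCompletion K)) (toClosureValuationSubring v) 𝓨.total (𝓨.modelPointsEquiv.symm x)).left
        (specFractionFieldι (closureValuationSubring (v.adicCompletion K)) (toClosureValuationSubring v)).left).symm with hTA
  set TC := 𝒞.fibreBaseChangeIso (𝓨.genericIso'.inv.left ≫ pullback.fst 𝓨.total.hom (specGenericPoint (valuationSubringAtPrime K v) K)) x''.left ≪≫
      𝒞.fibreCongrPtIso hptC ≪≫ (𝒞.fibreBaseChangeIso (extendPoint (closureValuationSubring (v.adicCompletion K)) (toClosureValuationSubring v) 𝓨.total (𝓨.modelPointsEquiv.symm x'')).left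
        (specFractionFieldι (closureValuationSubring (v.adicCompletion K)) (toClosureValuationSubring v)).left).symm with hTC
  set SA := 𝒜.fibreBaseChangeIso (pullback.fst 𝓨.total.hom (specResidueField v)) (𝓨.geomReductionMap x).left ≪≫ 𝒜.fibreCongrPtIso hsptA ≪≫
      (𝒜.fibreBaseChangeIso (extendPoint (closureValuationSubring (v.adicCompletion K)) (toClosureValuationSubring v) 𝓨.total (𝓨.modelPointsEquiv.symm x)).left
        ((geomClosedPointIsoSpecResidueField v).inv.left ≫ (specRingHomι (closureValuationSubring (v.adicCompletion K)) (toClosureValuationSubring v)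
          (IsLocalRing.residue (closureValuationSubring (v.adicCompletion K)))).left)).symm with hSA
  set SC := 𝒞.fibreBaseChangeIso (pullback.fst 𝓨.total.hom (specResidueField v)) (𝓨.geomReductionMap x'').left ≪≫ 𝒞.fibreCongrPtIso hsptC ≪≫
      (𝒞.fibreBaseChangeIso (extendPoint (closureValuationSubring (v.adicCompletion K)) (toClosureValuationSubring v) 𝓨.total (𝓨.modelPointsEquiv.symm x'')).left
        ((geomClosedPointIsoSpecResidueField v).inv.left ≫ (specRingHomι (closureValuationSubring (v.adicCompletion K)) (toClosureValuationSubring v)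
          (IsLocalRing.residue (closureValuationSubring (v.adicCompletion K)))).left)).symm with hSC
  -- the homomorphism in ★ (ν8R-model)'s currency
  let u : ((𝒜.baseChange (𝓨.genericIso'.inv.left ≫ pullback.fst 𝓨.total.hom (specGenericPoint (valuationSubringAtPrime K v) K))).baseChange x.left).X ⟶
      ((𝒞.baseChange (𝓨.genericIso'.inv.left ≫ pullback.fst 𝓨.total.hom (specGenericPoint (valuationSubringAtPrime K v) K))).baseChange x''.left).X :=
    TA.hom.hom.hom.hom ≫ v_ ≫ TC.inv.hom.hom.hom
  haveI : IsMonHom u := by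
    change IsMonHom (TA.hom.hom.hom.hom ≫ v_ ≫ TC.inv.hom.hom.hom); infer_instance
  obtain ⟨ubar, hubar, hi, hii, -, -, hvb, -⟩ := exists_specialFibre_hom_reduction_model 𝓨 𝒜 𝒞 x x'' u
  haveI := hubar
  haveI hvbar : IsMonHom (SA.inv.hom.hom.hom ≫ ubar ≫ SC.hom.hom.hom.hom) := by infer_instance
  refine ⟨SA.inv.hom.hom.hom ≫ ubar ≫ SC.hom.hom.hom.hom, hvbar, ?_, ?_, ?_⟩
  · -- (i)
    intro hfin hsurj
    haveI := hfin; haveI := hsurj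
    haveI := isIso_left_hom_of_avIso TA; haveI := isIso_left_inv_of_avIso TC
    haveI := isIso_left_inv_of_avIso SA; haveI := isIso_left_hom_of_avIso SC
    have hul : u.left = TA.hom.hom.hom.hom.left ≫ v_.left ≫ TC.inv.hom.hom.hom.left := by
      simp only [u, Over.comp_left]
    haveI : IsFinite u.left := by rw [hul]; infer_instance
    haveI : Surjective u.left := by rw [hul]; infer_instance
    obtain ⟨hflat, hsb⟩ := hi inferInstance inferInstance
    haveI := hflat
    haveI : Surjective ubar.left := ⟨hsb⟩
    refine ⟨?_, ?_⟩
    · rw [Over.comp_left, Over.comp_left]; infer_instance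
    · rw [Over.comp_left, Over.comp_left]; infer_instance
  · -- (ii)
    intro f g hf hg hfg
    have e1 : baseChangeHom (baseChangeHom f _) x.left ≫ TA.hom.hom.hom.hom = TA.hom.hom.hom.hom ≫ (Over.pullback _).map (baseChangeHom f _) :=
      comp_three_hom_eq _ _ _ _ hptA 𝒜 𝒜 f
    have e2 : TC.inv.hom.hom.hom ≫ baseChangeHom (baseChangeHom g _) x''.left = (Over.pullback _).map (baseChangeHom g _) ≫ TC.inv.hom.hom.hom :=
      three_inv_comp_eq _ _ _ _ hptC 𝒞 𝒞 g
    have hu : baseChangeHom (baseChangeHom f _) x.left ≫ u = u ≫ baseChangeHom (baseChangeHom g _) x''.left := by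
      change baseChangeHom (baseChangeHom f _) x.left ≫ (TA.hom.hom.hom.hom ≫ v_ ≫ TC.inv.hom.hom.hom) =
        (TA.hom.hom.hom.hom ≫ v_ ≫ TC.inv.hom.hom.hom) ≫ baseChangeHom (baseChangeHom g _) x''.left
      rw [reassoc_of% e1, reassoc_of% hfg, Category.assoc, Category.assoc, e2]
    have h2 := hii f g hu
    -- transport through the special three-piece isomorphisms
    have hA : SA.inv.hom.hom.hom ≫ baseChangeHom (baseChangeHom f _) (𝓨.geomReductionMap x).left =
        (Over.pullback _).map (baseChangeHom f _) ≫ SA.inv.hom.hom.hom := three_inv_comp_eq _ _ _ _ hsptA 𝒜 𝒜 f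
    have hC : baseChangeHom (baseChangeHom g _) (𝓨.geomReductionMap x'').left ≫ SC.hom.hom.hom.hom =
        SC.hom.hom.hom.hom ≫ (Over.pullback _).map (baseChangeHom g _) := comp_three_hom_eq _ _ _ _ hsptC 𝒞 𝒞 g
    rw [← reassoc_of% hA, reassoc_of% h2, hC]
    simp only [Category.assoc]
  · -- (v-b)
    intro 𝒦 incl _ hk
    have hk' : ((Over.pullback (specFractionFieldι (closureValuationSubring (v.adicCompletion K)) (toClosureValuationSubring v)).left).map incl ≫
        TA.inv.hom.hom.hom) ≫ u = 1 := by
      simp only [u, Category.assoc]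
      rw [← Category.assoc TA.inv.hom.hom.hom, avIso_inv_hom_hom_hom_comp_hom, Category.id_comp, ← Category.assoc, hk, MonObj.one_comp]
    have h := hvb 𝒦 incl hk'
    rw [← Category.assoc, ← Category.assoc, h, MonObj.one_comp]

end Head

end AbelianSchemeOver

end Literature.AlgebraicGeometry.AbelianSchemes

end
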